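/-
Copyright (c) 2026. Released under Apache 2.0 license as described in the file LICENSE.
-/
import Summits.RiemannHypothesis.RiemannHypothesis.Theorems.LiDirichletKernelStructure
import Summits.RiemannHypothesis.RiemannHypothesis.Theorems.LiDirichletTrendMainTerm
import Mathlib.Analysis.Complex.ExponentialBounds
import HarnessLib

/-!
# KERNEL LINEAGE K-χ — the Dirichlet leaf's inequality holds UNCONDITIONALLY on the certified range `3 ≤ n ≤ 48`

RH-FREE DATA + RH-free trend theorems (0 kit).  bears_on: LADDER-RH L-D (COLUMN 4 LI, DATA rung; Dirichlet rows) →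
the rung leaf L-P(P1⁺χ) `LiTheory.LiDirichletAsymptoticLaw` (`Theorems/LiDirichletAsymptoticDefs.lean`), whose BMOR-form
conclusion is `|Re λ_χ(n) − charLiMainTerm q n| ≤ √n log(qn)` for `n ≥ 900`, GIVEN the zeros of `L(s, χ)` to height `2√n`
on the critical line (and BMOR Thm 1.1).
WHAT THIS IS NOT: a finite certified range complements the leaf at small `n`; it does not prove the leaf, needs no zero
input, and is not evidence for GRH; nothing here bears on the truth of RH/GRH.

* `abs_liCoeffCharRe_sub_charLiMainTerm_lt_sqrt_add` — for every primitive `χ` of conductor `2 ≤ q ≤ 13` and every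
  `1 ≤ n ≤ 48`: `|Re λ_χ(n) − ((n/2) log n + C₁ n + (n/2) log q)| < √n + 3/2` — from the kernel row
  `|lt_χ(n)| < √n` (`abs_charLiOsc_lt_sqrt`), the RH-free trend theorem `|lb_χ(n) − charLiMainTerm q n| ≤ 3/2`
  (`abs_charLiTrend_sub_charLiMainTerm_le`, T-D2 + PART H) and the split `Re λ_χ = lb_χ + lt_χ` (T-D2s).
* `abs_liCoeffCharRe_sub_charLiMainTerm_lt` — hence the LEAF'S INEQUALITY `|Re λ_χ(n) − charLiMainTerm q n| < √n log(qn)`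
  holds UNCONDITIONALLY for `3 ≤ n ≤ 48` and conductor `≤ 13` (`√n (log(qn) − 1) ≥ √3 (log 9 − 1) ≥ 3/2`); at `n = 1, 2`
  it also holds numerically (margins `≥ 0.4`) but is not certified here (it needs enclosures of `C₁`).
-/

set_option linter.dupNamespace false

namespace Summit.RiemannHypothesis.RiemannHypothesis.Theorems.LiDirichletKernel

open Literature.NumberTheory.LFunctions Literature.NumberTheory.LFunctions.LiDirichlet
open Summit.RiemannHypothesis.RiemannHypothesis.Theorems.LiTheory

/-- **`|Re λ_χ(n) − charLiMainTerm q n| < √n + 3/2`** for every primitive character of conductor `2 ≤ q ≤ 13` and every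
`1 ≤ n ≤ 48` (`charLiMainTerm q n = (n/2) log n + C₁ n + (n/2) log q`).  RH-FREE (kernel rows + trend theorems). -/
theorem abs_liCoeffCharRe_sub_charLiMainTerm_lt_sqrt_add {q : ℕ} [NeZero q] (hq : 2 ≤ q) (hq' : q ≤ 13)
    (χ : DirichletCharacter ℂ q) (hprim : χ.IsPrimitive) {n : ℕ} (hn : 1 ≤ n) (hn' : n ≤ 48) :
    |liCoeffCharRe χ n - charLiMainTerm q n| < Real.sqrt n + 3 / 2 := by
  have hsplit := liDirichletSplit_holds q χ hprim (by omega) n hn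
  have hosc := abs_charLiOsc_lt_sqrt hq hq' χ hprim hn hn'
  have htr := abs_charLiTrend_sub_charLiMainTerm_le χ hn
  rw [hsplit, show charLiTrend χ n + charLiOsc χ n - charLiMainTerm q n
    = (charLiTrend χ n - charLiMainTerm q n) + charLiOsc χ n by ring]
  exact (abs_add_le _ _).trans_lt (by linarith)

/-- `√n (log(qn) − 1) ≥ 3/2` for `n ≥ 3`, `q ≥ 3` (`log 9 ≥ 2 > 1 + …`, `√3 ≥ 3/2`). -/
theorem three_halves_le_sqrt_mul_log_sub_one {q n : ℕ} (hq : 3 ≤ q) (hn : 3 ≤ n) :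
    (3 : ℝ) / 2 ≤ Real.sqrt n * (Real.log ((q : ℝ) * n) - 1) := by
  have hq3 : (3 : ℝ) ≤ q := by exact_mod_cast hq
  have hn3 : (3 : ℝ) ≤ n := by exact_mod_cast hn
  have hsqrt : (3 : ℝ) / 2 ≤ Real.sqrt n := by
    rw [Real.le_sqrt (by norm_num) (by positivity)]
    nlinarith
  have hlog : (2 : ℝ) ≤ Real.log ((q : ℝ) * n) := by
    rw [Real.le_log_iff_exp_le (by positivity)]
    have h9 : (9 : ℝ) ≤ (q : ℝ) * n := by nlinarith
    refine le_trans ?_ h9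
    have he := Real.exp_one_lt_d9
    have : Real.exp 2 = Real.exp 1 ^ 2 := by rw [← Real.exp_nat_mul]; norm_num
    rw [this]
    nlinarith [Real.exp_pos 1]
  nlinarith

/-- **THE LEAF'S INEQUALITY ON THE CERTIFIED RANGE**: `|Re λ_χ(n) − charLiMainTerm q n| < √n log(qn)` for every primitive
character of conductor `2 ≤ q ≤ 13` and every `3 ≤ n ≤ 48` — UNCONDITIONAL (no zero input), by the kernel-certified
table and the RH-free trend theorems; the leaf `LiDirichletAsymptoticLaw` asserts the same shape for `n ≥ 900` under GRH
to height `2√n` and BMOR.  RH-FREE DATA; WHAT THIS IS NOT: not the leaf, not evidence for GRH. -/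
theorem abs_liCoeffCharRe_sub_charLiMainTerm_lt {q : ℕ} [NeZero q] (hq : 2 ≤ q) (hq' : q ≤ 13)
    (χ : DirichletCharacter ℂ q) (hprim : χ.IsPrimitive) {n : ℕ} (hn : 3 ≤ n) (hn' : n ≤ 48) :
    |liCoeffCharRe χ n - charLiMainTerm q n| < Real.sqrt n * Real.log ((q : ℝ) * n) := by
  -- `q = 2` carries no primitive character (`classRows 2 = []`)
  rcases (show q = 2 ∨ 3 ≤ q by omega) with rfl | hq3
  · obtain ⟨rows, hmem, -⟩ := exists_classRows_of_isPrimitive hq hq' χ hprim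
    simp [classRows] at hmem
  have h1 := abs_liCoeffCharRe_sub_charLiMainTerm_lt_sqrt_add hq hq' χ hprim (by omega) hn'
  have h2 := three_halves_le_sqrt_mul_log_sub_one hq3 hn
  nlinarith

end Summit.RiemannHypothesis.RiemannHypothesis.Theorems.LiDirichletKernel
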